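import Summits.Ventures.HodgeRepro2.PairingTransfer
import Summits.Ventures.HodgeRepro2.KunnethProjector
import Summits.Ventures.HodgeRepro2.IsotypicProjector

/-!
# T4Composition — the pieces of the bridge fit together (Tier 4, T4-A)

Seat p3 of the blind cell `pub-hodge-repro2` (Tier 4, README §6).  This file composes the three
Tier-4 files of seat p3:

* `PairingTransfer` takes the algebraicity of the Weil-line projector and of its transpose as
  structure fields (`proj_alg`, `projT_alg`);
* `KunnethProjector` and `IsotypicProjector` exhibit the two factors of that projector as
  elements of the ℚ-subalgebra of `End_ℚ H⁴(B,ℚ)` generated by elementary algebraic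
  correspondences (the graph of `[n]` and the pull-backs by the `𝐅`-endomorphisms of `B`).

Here the missing link is proved: the endomorphisms preserving the algebraic classes form a
SUBALGEBRA (`preservingSubalgebra`), so every element of the ℚ-algebra generated by elementary
algebraic correspondences preserves algebraic classes (`mem_preserving_of_mem_adjoin`); the
composite `P_k(N) · e` of a Künneth operator and an isotypic projector lies in the algebra
generated by `N`, `ρ₁(𝐅)`, `ρ₂(𝐅)` (`kunneth_mul_isotypic_mem_adjoin`) and is idempotent when the
two factors commute (`mul_idem_of_commute`); and the closing theorem of `PairingTransfer` is
restated with the projector's algebraicity DERIVED from generator membership rather than assumed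
(`weilLine_le_alg_of_mem_adjoin`).

Axioms: propext, Classical.choice, Quot.sound.
-/

namespace Summit.Ventures.HodgeRepro2.T4Composition

open Module
open Summit.Ventures.HodgeRepro2.PairingTransfer
open Summit.Ventures.HodgeRepro2.KunnethProjector
open Summit.Ventures.HodgeRepro2.IsotypicProjector

variable {V : Type*} [AddCommGroup V] [Module ℚ V]

/-- The endomorphisms of `V` preserving a subspace `A` (the algebraic classes) form a
ℚ-subalgebra of `End_ℚ V`. -/
def preservingSubalgebra (A : Submodule ℚ V) : Subalgebra ℚ (Module.End ℚ V) where
  carrier := {T | ∀ a ∈ A, T a ∈ A}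
  mul_mem' := by
    intro T U hT hU a ha
    exact hT _ (hU a ha)
  add_mem' := by
    intro T U hT hU a ha
    exact A.add_mem (hT a ha) (hU a ha)
  algebraMap_mem' := by
    intro q a ha
    simpa [Module.algebraMap_end_apply] using A.smul_mem q ha

/-- Membership in the preserving subalgebra. -/
theorem mem_preservingSubalgebra_iff (A : Submodule ℚ V) (T : Module.End ℚ V) :
    T ∈ preservingSubalgebra A ↔ ∀ a ∈ A, T a ∈ A := Iff.rfl

/-- ALGEBRAIC CORRESPONDENCES PRESERVE ALGEBRAIC CLASSES: if every generator preserves `A`, so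
does every element of the ℚ-algebra they generate. -/
theorem mem_preserving_of_mem_adjoin (A : Submodule ℚ V) {gens : Set (Module.End ℚ V)}
    (hgens : ∀ g ∈ gens, ∀ a ∈ A, g a ∈ A) {T : Module.End ℚ V}
    (hT : T ∈ Algebra.adjoin ℚ gens) : ∀ a ∈ A, T a ∈ A := by
  have hle : Algebra.adjoin ℚ gens ≤ preservingSubalgebra A :=
    Algebra.adjoin_le fun g hg => hgens g hg
  exact hle hT

/-- The product of two commuting idempotents is idempotent. -/
theorem mul_idem_of_commute {p q : Module.End ℚ V} (hp : ∀ v, p (p v) = p v)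
    (hq : ∀ v, q (q v) = q v) (hpq : ∀ v, p (q v) = q (p v)) (v : V) :
    (p * q) ((p * q) v) = (p * q) v := by
  simp only [Module.End.mul_apply]
  rw [← hpq (q v), hq v, hp (q v)]

section Generators

variable {F : Type*} [Field F] [Algebra ℚ F] {ι : Type*} [Fintype ι] [DecidableEq ι]

/-- THE WEIL-LINE PROJECTOR IS IN THE CORRESPONDENCE ALGEBRA: the product of a Künneth operator
`P_k(N)` and an isotypic projector `e` lies in the ℚ-algebra generated by `N`, `ρ₁(F)`, `ρ₂(F)` —
for the transfer, by the graph of `[n]` and the pull-backs by the endomorphisms of `B`. -/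
theorem kunneth_mul_isotypic_mem_adjoin (N : Module.End ℚ V) (n d k : ℕ) (A : TwoActions F V)
    (s : ι → (F →ₐ[ℚ] F)) (i₀ : ι) (θ : F) :
    kunnethOperator N n d k * isotypicProjector A s i₀ θ ∈
      Algebra.adjoin ℚ (({N} ∪ (Set.range A.ρ₁ ∪ Set.range A.ρ₂)) : Set (Module.End ℚ V)) := by
  apply Subalgebra.mul_mem
  · exact Algebra.adjoin_mono Set.subset_union_left (kunnethOperator_mem_adjoin N n d k)
  · exact Algebra.adjoin_mono Set.subset_union_right (isotypicProjector_mem_adjoin A s i₀ θ)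

end Generators

section Closing

variable {V' : Type*} [AddCommGroup V'] [Module ℚ V']

/-- The transfer data assembled from a pairing, the algebraic classes, generating sets of
algebraic correspondences in both degrees, and a projector with its transpose lying in the
generated algebras. -/
def transferDataOfAdjoin (pair : V' →ₗ[ℚ] V →ₗ[ℚ] ℚ) (alg : Submodule ℚ V)
    (alg' : Submodule ℚ V') {gens : Set (Module.End ℚ V)} {gens' : Set (Module.End ℚ V')}
    (hgens : ∀ g ∈ gens, ∀ a ∈ alg, g a ∈ alg) (hgens' : ∀ g ∈ gens', ∀ c ∈ alg', g c ∈ alg')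
    {proj : Module.End ℚ V} (hproj : proj ∈ Algebra.adjoin ℚ gens)
    (proj_idem : ∀ v, proj (proj v) = proj v) {projT : Module.End ℚ V'}
    (hprojT : projT ∈ Algebra.adjoin ℚ gens')
    (pair_projT : ∀ c w, pair (projT c) w = pair c (proj w)) : TransferData V V' where
  pair := pair
  alg := alg
  alg' := alg'
  proj := proj
  proj_idem := proj_idem
  projT := projT
  pair_projT := pair_projT
  proj_alg := mem_preserving_of_mem_adjoin alg hgens hproj
  projT_alg := mem_preserving_of_mem_adjoin alg' hgens' hprojT

/-- THE CLOSING THEOREM WITH THE PROJECTOR'S ALGEBRAICITY DERIVED: if the projector onto the Weil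
line and its transpose are polynomials in elementary algebraic correspondences (as
`KunnethProjector` and `IsotypicProjector` show for the two factors), then one non-zero period of
an algebraic class of complementary degree against the Weil line makes the Weil line algebraic —
under Lieberman's theorem and the `𝐅`-line property. -/
theorem weilLine_le_alg_of_mem_adjoin (pair : V' →ₗ[ℚ] V →ₗ[ℚ] ℚ) (alg : Submodule ℚ V)
    (alg' : Submodule ℚ V') {gens : Set (Module.End ℚ V)} {gens' : Set (Module.End ℚ V')}
    (hgens : ∀ g ∈ gens, ∀ a ∈ alg, g a ∈ alg) (hgens' : ∀ g ∈ gens', ∀ c ∈ alg', g c ∈ alg')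
    {proj : Module.End ℚ V} (hproj : proj ∈ Algebra.adjoin ℚ gens)
    (proj_idem : ∀ v, proj (proj v) = proj v) {projT : Module.End ℚ V'}
    (hprojT : projT ∈ Algebra.adjoin ℚ gens')
    (pair_projT : ∀ c w, pair (projT c) w = pair c (proj w))
    (hL : (transferDataOfAdjoin pair alg alg' hgens hgens' hproj proj_idem hprojT
      pair_projT).NumericalImpliesHomological')
    (hline : (transferDataOfAdjoin pair alg alg' hgens hgens' hproj proj_idem hprojT
      pair_projT).LineProperty)
    {c : V'} (hc : c ∈ alg') {w : V} (hw : w ∈ LinearMap.range proj) (hne : pair c w ≠ 0) :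
    LinearMap.range proj ≤ alg :=
  (transferDataOfAdjoin pair alg alg' hgens hgens' hproj proj_idem hprojT
    pair_projT).weilLine_le_alg_of_pair_ne_zero hL hline hc hw hne

end Closing

end Summit.Ventures.HodgeRepro2.T4Composition
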